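import Summits.ResolutionOfSingularities.ResolutionOfSingularities.Theorems.FrobeniusLadderFInjectiveMacaulayficationPolynomialFrobeniusDivision
import Summits.ResolutionOfSingularities.ResolutionOfSingularities.Theorems.FrobeniusLadderFInjectiveMacaulayficationDeformation
import Summits.ResolutionOfSingularities.ResolutionOfSingularities.Theorems.FrobeniusLadderFInjectiveMacaulayficationDegreeZeroDescent
import Literature.RingTheory.TightClosure.FRationalNormal
import Mathlib.RingTheory.Regular.Flat
import Mathlib.RingTheory.Localization.Submodule
import Mathlib.RingTheory.KrullDimension.Regular
import HarnessLib

/-!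
# The Cohen–Macaulay + F-injective clause ascends along `A → A[t]_(𝔪, g)`, ALL residue fields
# (crux `FInjectiveMacaulayfication` stmt-ResolutionOfSingularities-15315, chain w45a; R11.11 cylinder producer, step S1;
# owner res-D-pv-017 AS res-L1-w45a-stub-5)

Support file for crux stmt-ResolutionOfSingularities-15315 (`FrobeniusLadder.FInjectiveMacaulayfication`), chain w45a.
[OURS · L1 W4.5a] — NOT a statement of any manuscript; AI-written, weaker than expert review.

Let `(A, 𝔪)` be a Noetherian local ring of characteristic `p` satisfying the crux's clause (every system of parameters weakly
regular with Frobenius-closed ideal), `g ∈ A[t]` monic of positive degree and `P = 𝔪A[t] + (g)` prime (equivalently `ḡ ∈ k[t]`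
irreducible — separable OR NOT). Then `B = A[t]_P` satisfies the clause (`clause_polynomial_localization_of_monic`). Proof: for an
s.o.p. `x` of `A`, `(x, g)` is a `B`-regular sequence in `𝔪_B` (flat base change; `g` monic is regular modulo `(x)`,
`PolynomialLocalizationClause.mem_map_C_of_monic_mul_mem`) with `√(x, g)B = 𝔪_B`, so `dim B = d + 1` and `B` is Cohen–Macaulay
(`SopWeaklyRegular.stub_sopWeaklyRegular`); `(x, g)B` is Frobenius closed by clearing denominators and
`PolynomialLocalizationClause.mem_sup_span_of_pow_mem`; every parameter ideal by `OneSop.isFrobeniusClosed_of_isFrobeniusClosed_sop`.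
This is the local-ring step of «F-injectivity + CM ascend along `R → R[t]`» behind the cylinder producer of R11.11; the finite
algebra `A[t]/(g)` (where inseparable `ḡ` is a genuine barrier) is never used. No definitions, no named facts.
[folklore; cf. DattaMurayama2020 Thm A for the smooth map `A → A[t]`]
-/

-- single-problem summit: the doubled namespace component is forced
set_option linter.dupNamespace false

noncomputable section

open Polynomial IsLocalRing RingTheory.Sequence Literature.RingTheory.TightClosure

namespace Summit.ResolutionOfSingularities.ResolutionOfSingularities.Theorems.FInjectiveMacaulayfication.PolynomialLocalizationClause

open Summit.ResolutionOfSingularities.ResolutionOfSingularities.Theorems.FInjectiveMacaulayfication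
open Summit.ResolutionOfSingularities.ResolutionOfSingularities.Theorems

/-- `(a · f)^n ∈ J` as soon as `a · f^n ∈ J` (`n ≠ 0`). [folklore] -/
theorem mul_pow_mem_of_mul_pow_mem {R : Type*} [CommRing R] (J : Ideal R) {a f : R} {n : ℕ} (hn : n ≠ 0)
    (h : a * f ^ n ∈ J) : (a * f) ^ n ∈ J := by
  obtain ⟨k, rfl⟩ := Nat.exists_eq_succ_of_ne_zero hn
  rw [mul_pow, pow_succ, mul_assoc]
  exact J.mul_mem_left _ h

set_option maxHeartbeats 1600000 in
/-- **The clause ascends along `A → A[t]_(𝔪, g)`** for `g` monic of positive degree with `𝔪A[t] + (g)` prime — every residue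
field, separable or not. See the module docstring. [folklore; cf. DattaMurayama2020 Thm A] -/
theorem clause_polynomial_localization_of_monic (p : ℕ) [Fact p.Prime] (A : Type) [CommRing A] [IsNoetherianRing A]
    [IsLocalRing A] [CharP A p]
    (hA : ∀ d : ℕ, ringKrullDim A = d → ∀ s : Fin d → A, (Ideal.span (Set.range s)).radical.IsMaximal →
      IsWeaklyRegular A (List.ofFn s) ∧
      ∀ y : A, (∃ e : ℕ, y ^ p ^ e ∈ Ideal.span ((fun z : A => z ^ p ^ e) '' (Ideal.span (Set.range s) : Set A))) →
        y ∈ Ideal.span (Set.range s))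
    (g : A[X]) (hg : g.Monic) (hg1 : 0 < g.natDegree) (P : Ideal A[X]) [P.IsPrime]
    (hP : P = (maximalIdeal A).map (C : A →+* A[X]) ⊔ Ideal.span {g}) :
    ∀ d : ℕ, ringKrullDim (Localization.AtPrime P) = d → ∀ s : Fin d → Localization.AtPrime P,
      (Ideal.span (Set.range s)).radical.IsMaximal →
      IsWeaklyRegular (Localization.AtPrime P) (List.ofFn s) ∧
      ∀ y : Localization.AtPrime P, (∃ e : ℕ, y ^ p ^ e ∈ Ideal.span
        ((fun z : Localization.AtPrime P => z ^ p ^ e) ''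
          (Ideal.span (Set.range s) : Set (Localization.AtPrime P)))) → y ∈ Ideal.span (Set.range s) := by
  classical
  haveI : CharP (Localization.AtPrime P) p := DegreeZeroDescent.charP_localization_atPrime p P
  haveI : Module.Flat A[X] (Localization.AtPrime P) := IsLocalization.flat _ P.primeCompl
  haveI : Module.Flat A (Localization.AtPrime P) := Module.Flat.trans A A[X] _
  -- an s.o.p. `x` of `A`, weakly regular with Frobenius-closed bracket powers
  obtain ⟨d, hd⟩ := exists_ringKrullDim_eq_nat (R := A)
  obtain ⟨x, hx⟩ := exists_isSystemOfParameters hd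
  obtain ⟨hxreg, hxF⟩ := hA d hd x (isSystemOfParameters_iff.mp hx).2
  have hιC : ∀ a : A, algebraMap A (Localization.AtPrime P) a = algebraMap A[X] (Localization.AtPrime P) (C a) := fun a =>
    IsScalarTower.algebraMap_apply A A[X] (Localization.AtPrime P) a
  have hCP : ∀ a ∈ maximalIdeal A, C a ∈ P := fun a ha => by
    rw [hP]; exact Ideal.mem_sup_left (Ideal.mem_map_of_mem _ ha)
  have hgP : g ∈ P := by rw [hP]; exact Ideal.mem_sup_right (Ideal.mem_span_singleton_self g)
  have hmaxB : ∀ z ∈ P, algebraMap A[X] (Localization.AtPrime P) z ∈ maximalIdeal (Localization.AtPrime P) := fun z hz =>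
    (IsLocalization.AtPrime.to_map_mem_maximal_iff (Localization.AtPrime P) P z).mpr hz
  have hxm : ∀ i, x i ∈ maximalIdeal A := fun i =>
    hx.2 ▸ Ideal.le_radical (Ideal.subset_span ⟨i, rfl⟩)
  -- the candidate s.o.p. `s₀ = (x/1, g/1)` of `B` and the list `rs` of its entries
  obtain ⟨s₀, hs₀⟩ : ∃ s₀ : Fin (d + 1) → Localization.AtPrime P,
      s₀ = Fin.snoc (fun i => algebraMap A (Localization.AtPrime P) (x i)) (algebraMap A[X] (Localization.AtPrime P) g) :=
    ⟨_, rfl⟩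
  have hs₀c : ∀ i : Fin d, s₀ (Fin.castSucc i) = algebraMap A (Localization.AtPrime P) (x i) := fun i => by
    rw [hs₀, Fin.snoc_castSucc]
  have hs₀l : s₀ (Fin.last d) = algebraMap A[X] (Localization.AtPrime P) g := by rw [hs₀, Fin.snoc_last]
  obtain ⟨rs, hrs_def⟩ : ∃ rs : List (Localization.AtPrime P), rs = List.ofFn s₀ := ⟨_, rfl⟩
  have hrs : rs = ((List.ofFn x).map (algebraMap A (Localization.AtPrime P))) ++
      [algebraMap A[X] (Localization.AtPrime P) g] := by
    rw [hrs_def, List.ofFn_succ', List.map_ofFn, List.concat_eq_append, hs₀l]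
    congr 1
    exact congrArg List.ofFn (funext fun i => hs₀c i)
  have hofList : Ideal.ofList rs = Ideal.span (Set.range s₀) := by
    rw [hrs_def, Ideal.ofList]
    congr 1
    ext r
    simp only [Set.mem_setOf_eq, List.mem_ofFn, Set.mem_range]
  have hmem : ∀ r ∈ rs, r ∈ maximalIdeal (Localization.AtPrime P) := by
    intro r hr
    rw [hrs, List.mem_append, List.mem_map, List.mem_singleton] at hr
    rcases hr with ⟨a, ha, rfl⟩ | rfl
    · obtain ⟨i, rfl⟩ := List.mem_ofFn.mp ha
      rw [hιC]; exact hmaxB _ (hCP _ (hxm i))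
    · exact hmaxB g hgP
  have hs₀mem : ∀ i, s₀ i ∈ maximalIdeal (Localization.AtPrime P) := fun i =>
    hmem _ (by rw [hrs_def]; exact List.mem_ofFn.mpr ⟨i, rfl⟩)
  -- `(x)·B ≤ (s₀)` and `g/1 ∈ (s₀)`
  have hxS : (Ideal.span (Set.range x)).map (algebraMap A (Localization.AtPrime P)) ≤ Ideal.span (Set.range s₀) := by
    rw [Ideal.map_span]
    apply Ideal.span_mono
    rintro _ ⟨_, ⟨i, rfl⟩, rfl⟩
    exact ⟨Fin.castSucc i, hs₀c i⟩
  have hgS : algebraMap A[X] (Localization.AtPrime P) g ∈ Ideal.span (Set.range s₀) :=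
    Ideal.subset_span ⟨Fin.last d, hs₀l⟩
  -- every prime `Q ⊇ (s₀)` contains `P·B = 𝔪_B` (so `√(s₀) = 𝔪_B`)
  have hPQ : ∀ (Q : Ideal (Localization.AtPrime P)) [Q.IsPrime], Ideal.span (Set.range s₀) ≤ Q →
      P ≤ Q.comap (algebraMap A[X] (Localization.AtPrime P)) := by
    intro Q _ hQ z hz
    rw [hP] at hz
    obtain ⟨z₁, hz₁, z₂, hz₂, rfl⟩ := Submodule.mem_sup.mp hz
    obtain ⟨c, rfl⟩ := Ideal.mem_span_singleton'.mp hz₂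
    rw [Ideal.mem_comap, map_add, map_mul]
    refine Q.add_mem ?_ (Q.mul_mem_left _ (hQ hgS))
    have h𝔪Q : (maximalIdeal A).map (C : A →+* A[X]) ≤ Q.comap (algebraMap A[X] (Localization.AtPrime P)) := by
      refine Ideal.map_le_iff_le_comap.mpr fun m hm => ?_
      rw [Ideal.mem_comap, Ideal.mem_comap, ← hιC]
      have hm' : m ∈ (Ideal.span (Set.range x)).radical := by rw [hx.2]; exact hm
      obtain ⟨N, hN⟩ := hm'
      exact Ideal.IsPrime.mem_of_pow_mem inferInstance N (by rw [← map_pow]; exact hQ (hxS (Ideal.mem_map_of_mem _ hN)))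
    exact h𝔪Q hz₁
  have hkey : ∀ (Q : Ideal (Localization.AtPrime P)) [Q.IsPrime], Ideal.span (Set.range s₀) ≤ Q →
      maximalIdeal (Localization.AtPrime P) ≤ Q := by
    intro Q _ hQ z hz
    obtain ⟨⟨f, u⟩, hfu⟩ := IsLocalization.mk'_surjective P.primeCompl z
    simp only at hfu
    subst hfu
    have hf : f ∈ P := (IsLocalization.AtPrime.mk'_mem_maximal_iff (Localization.AtPrime P) P f u).mp hz
    rw [IsLocalization.mk'_eq_mul_mk'_one]
    exact Q.mul_mem_right _ (hPQ Q hQ hf)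
  -- (x/1) is weakly regular on `B` (flat base change) and `g/1` is regular modulo `(x)B`
  have hreg1 : IsWeaklyRegular (Localization.AtPrime P) ((List.ofFn x).map (algebraMap A (Localization.AtPrime P))) :=
    hxreg.of_flat
  have h𝔵B : Ideal.ofList ((List.ofFn x).map (algebraMap A (Localization.AtPrime P))) =
      (Ideal.span (Set.range x)).map (algebraMap A (Localization.AtPrime P)) := by
    rw [← Ideal.map_ofList, Ideal.ofList]
    congr 2
    ext r
    simp only [Set.mem_setOf_eq, List.mem_ofFn, Set.mem_range]
  have hgreg : ∀ b : Localization.AtPrime P, algebraMap A[X] (Localization.AtPrime P) g * b ∈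
      (Ideal.span (Set.range x)).map (algebraMap A (Localization.AtPrime P)) →
      b ∈ (Ideal.span (Set.range x)).map (algebraMap A (Localization.AtPrime P)) := by
    intro b hb
    have hmapmap : (Ideal.span (Set.range x)).map (algebraMap A (Localization.AtPrime P)) =
        ((Ideal.span (Set.range x)).map (C : A →+* A[X])).map (algebraMap A[X] (Localization.AtPrime P)) := by
      rw [Ideal.map_map]; rfl
    rw [hmapmap] at hb ⊢
    obtain ⟨⟨f, u⟩, hfu⟩ := IsLocalization.mk'_surjective P.primeCompl b
    simp only at hfu
    subst hfu
    have hgf : algebraMap A[X] (Localization.AtPrime P) (g * f) ∈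
        ((Ideal.span (Set.range x)).map (C : A →+* A[X])).map (algebraMap A[X] (Localization.AtPrime P)) := by
      have : algebraMap A[X] (Localization.AtPrime P) (g * f) =
          algebraMap A[X] (Localization.AtPrime P) g * IsLocalization.mk' (Localization.AtPrime P) f u *
            algebraMap A[X] (Localization.AtPrime P) (u : A[X]) := by
        rw [mul_assoc, IsLocalization.mk'_spec, map_mul]
      rw [this]
      exact Ideal.mul_mem_right _ _ hb
    obtain ⟨⟨⟨j, hj⟩, ⟨m, hm⟩⟩, hjm⟩ := (IsLocalization.mem_map_algebraMap_iff P.primeCompl _).mp hgf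
    simp only at hjm
    rw [← map_mul] at hjm
    obtain ⟨⟨c, hc⟩, hcjm⟩ := IsLocalization.exists_of_eq (M := P.primeCompl) hjm
    simp only at hcjm
    have hmem' : g * (c * m * f) ∈ (Ideal.span (Set.range x)).map (C : A →+* A[X]) := by
      have : g * (c * m * f) = c * (g * f * m) := by ring
      rw [this, hcjm]
      exact Ideal.mul_mem_left _ _ hj
    have hf' := mem_map_C_of_monic_mul_mem (Ideal.span (Set.range x)) hg hmem'
    have hunit : IsUnit (algebraMap A[X] (Localization.AtPrime P) (c * m)) :=
      IsLocalization.map_units _ (⟨c * m, P.primeCompl.mul_mem hc hm⟩ : P.primeCompl)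
    rw [← Ideal.unit_mul_mem_iff_mem _ hunit, IsLocalization.mul_mk'_eq_mk'_of_mul, IsLocalization.mk'_eq_mul_mk'_one]
    exact Ideal.mul_mem_right _ _ (Ideal.mem_map_of_mem _ hf')
  have hreg2 : IsWeaklyRegular (Localization.AtPrime P ⧸ (Ideal.ofList ((List.ofFn x).map (algebraMap A (Localization.AtPrime P))) •
      (⊤ : Submodule (Localization.AtPrime P) (Localization.AtPrime P)))) [algebraMap A[X] (Localization.AtPrime P) g] := by
    rw [h𝔵B, Ideal.smul_eq_mul, Ideal.mul_top]
    refine (isWeaklyRegular_cons_iff _ _ _).mpr ⟨?_, IsWeaklyRegular.nil _ _⟩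
    intro m₁ m₂ h12
    induction m₁ using Submodule.Quotient.induction_on with | _ b₁ => ?_
    induction m₂ using Submodule.Quotient.induction_on with | _ b₂ => ?_
    have h12' : Submodule.Quotient.mk (p := (Ideal.span (Set.range x)).map (algebraMap A (Localization.AtPrime P)))
        (algebraMap A[X] (Localization.AtPrime P) g * b₁) =
        Submodule.Quotient.mk (algebraMap A[X] (Localization.AtPrime P) g * b₂) := by
      rw [← smul_eq_mul, ← smul_eq_mul, Submodule.Quotient.mk_smul, Submodule.Quotient.mk_smul]
      exact h12
    rw [Submodule.Quotient.eq] at h12' ⊢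
    rw [← mul_sub] at h12'
    exact hgreg _ h12'
  have hwreg : IsWeaklyRegular (Localization.AtPrime P) rs := by
    rw [hrs, isWeaklyRegular_append_iff]
    exact ⟨hreg1, hreg2⟩
  have hreg : IsRegular (Localization.AtPrime P) rs :=
    (isRegular_iff_isWeaklyRegular_of_subset_maximalIdeal hmem).mpr hwreg
  -- dimension of `B`: `dim B/(s₀) = 0`, so `dim B = d + 1`
  have hlen : rs.length = d + 1 := by rw [hrs_def, List.length_ofFn]
  have hnt : Nontrivial (Localization.AtPrime P ⧸ Ideal.ofList rs) := by
    refine Ideal.Quotient.nontrivial_iff.mpr fun htop => ?_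
    have := hreg.2
    rw [Ideal.smul_eq_mul, Ideal.mul_top] at this
    exact this htop.symm
  have h0 : ringKrullDim (Localization.AtPrime P ⧸ Ideal.ofList rs) = 0 := by
    haveI := hnt
    refine le_antisymm ?_ ringKrullDim_nonneg_of_nontrivial
    have hKD : Ring.KrullDimLE 0 (Localization.AtPrime P ⧸ Ideal.ofList rs) := by
      refine Ring.KrullDimLE.mk₀ fun Q hQ => ?_
      have hQ' : Q.comap (Ideal.Quotient.mk (Ideal.ofList rs)) = maximalIdeal (Localization.AtPrime P) := by
        refine le_antisymm (IsLocalRing.le_maximalIdeal (Ideal.IsPrime.ne_top inferInstance)) (hkey _ ?_)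
        intro z hz
        rw [← hofList] at hz
        rw [Ideal.mem_comap, Ideal.Quotient.eq_zero_iff_mem.mpr hz]
        exact Q.zero_mem
      have hmax : (Q.comap (Ideal.Quotient.mk (Ideal.ofList rs))).IsMaximal := hQ' ▸ IsLocalRing.maximalIdeal.isMaximal _
      rcases Ideal.map_eq_top_or_isMaximal_of_surjective (Ideal.Quotient.mk (Ideal.ofList rs)) Ideal.Quotient.mk_surjective hmax
        with h | h
      · rw [Ideal.map_comap_of_surjective _ Ideal.Quotient.mk_surjective] at h
        exact absurd h (Ideal.IsPrime.ne_top hQ)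
      · rw [Ideal.map_comap_of_surjective _ Ideal.Quotient.mk_surjective] at h
        exact h
    exact (Order.krullDimLE_iff _ _).mp hKD
  have hdimB : ringKrullDim (Localization.AtPrime P) = ((d + 1 : ℕ) : WithBot ℕ∞) := by
    have h := ringKrullDim_add_length_eq_ringKrullDim_of_isRegular rs hreg
    rw [h0, hlen, zero_add] at h
    exact h.symm
  -- `B` is Cohen–Macaulay
  have hCMB : ∀ ⦃n : ℕ⦄ (u : Fin n → Localization.AtPrime P), IsSystemOfParameters u →
      IsWeaklyRegular (Localization.AtPrime P) (List.ofFn u) :=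
    FRationalModification.SopWeaklyRegular.stub_sopWeaklyRegular ⟨rs, hreg, hmem, by rw [hdimB, hlen]⟩
  -- `s₀` is a system of parameters with Frobenius-closed ideal
  have hs₀sop : IsSystemOfParameters s₀ := by
    refine ⟨hdimB, le_antisymm ?_ ?_⟩
    swap
    · rw [Ideal.radical_eq_sInf]
      exact le_sInf fun Q hQ => by haveI := hQ.2; exact hkey Q hQ.1
    exact (Ideal.IsPrime.radical_le_iff (IsLocalRing.maximalIdeal.isMaximal (Localization.AtPrime P)).isPrime').mpr
      (Ideal.span_le.mpr (by rintro _ ⟨i, rfl⟩; exact hs₀mem i))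
  have hJ₁ : ((Ideal.span (Set.range x)).map (C : A →+* A[X]) ⊔ Ideal.span {g}).map (algebraMap A[X] (Localization.AtPrime P)) ≤
      Ideal.span (Set.range s₀) := by
    rw [Ideal.map_sup, Ideal.map_map, Ideal.map_span _ {g}, Set.image_singleton]
    refine sup_le ?_ ((Ideal.span_singleton_le_iff_mem _).mpr hgS)
    have : (algebraMap A[X] (Localization.AtPrime P)).comp (C : A →+* A[X]) = algebraMap A (Localization.AtPrime P) :=
      RingHom.ext fun a => (hιC a).symm
    rw [this]
    exact hxS
  have hF₀ : IsFrobeniusClosed p (Ideal.span (Set.range s₀)) := by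
    rw [isFrobeniusClosed_iff]
    rintro y ⟨e, hy⟩
    have hq0 : p ^ e ≠ 0 := pow_ne_zero _ (Fact.out : p.Prime).ne_zero
    -- the Frobenius power of `(s₀)` sits inside `J·B`, `J = (x^[q])A[t] + (g^q)`
    have hJ : Ideal.span ((fun z : Localization.AtPrime P => z ^ p ^ e) '' (Ideal.span (Set.range s₀) : Set (Localization.AtPrime P))) ≤
        ((frobeniusPower (p ^ e) (Ideal.span (Set.range x))).map (C : A →+* A[X]) ⊔ Ideal.span {g ^ p ^ e}).map
          (algebraMap A[X] (Localization.AtPrime P)) := by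
      rw [← frobeniusPower_def, frobeniusPower_span, Ideal.span_le]
      rintro _ ⟨_, ⟨i, rfl⟩, rfl⟩
      refine Fin.lastCases ?_ (fun j => ?_) i
      · show s₀ (Fin.last d) ^ p ^ e ∈ _
        rw [hs₀l, ← map_pow]
        exact Ideal.mem_map_of_mem _ (Ideal.mem_sup_right (Ideal.mem_span_singleton_self _))
      · show s₀ (Fin.castSucc j) ^ p ^ e ∈ _
        rw [hs₀c, hιC, ← map_pow, ← map_pow]
        exact Ideal.mem_map_of_mem _ (Ideal.mem_sup_left (Ideal.mem_map_of_mem _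
          (pow_mem_frobeniusPower (Ideal.subset_span ⟨j, rfl⟩))))
    replace hy := hJ hy
    obtain ⟨⟨f, u⟩, hfu⟩ := IsLocalization.mk'_surjective P.primeCompl y
    simp only at hfu
    subst hfu
    have hfq : algebraMap A[X] (Localization.AtPrime P) (f ^ p ^ e) ∈
        ((frobeniusPower (p ^ e) (Ideal.span (Set.range x))).map (C : A →+* A[X]) ⊔ Ideal.span {g ^ p ^ e}).map
          (algebraMap A[X] (Localization.AtPrime P)) := by
      have : algebraMap A[X] (Localization.AtPrime P) (f ^ p ^ e) =
          IsLocalization.mk' (Localization.AtPrime P) f u ^ p ^ e * algebraMap A[X] (Localization.AtPrime P) (u : A[X]) ^ p ^ e := by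
        rw [← mul_pow, IsLocalization.mk'_spec, map_pow]
      rw [this]
      exact Ideal.mul_mem_right _ _ hy
    obtain ⟨⟨⟨j, hj⟩, ⟨m, hm⟩⟩, hjm⟩ := (IsLocalization.mem_map_algebraMap_iff P.primeCompl _).mp hfq
    simp only at hjm
    rw [← map_mul] at hjm
    obtain ⟨⟨c, hc⟩, hcjm⟩ := IsLocalization.exists_of_eq (M := P.primeCompl) hjm
    simp only at hcjm
    -- `f' = c m f` has `f'^q ∈ J`
    have hf'q : (c * m * f) ^ p ^ e ∈
        (frobeniusPower (p ^ e) (Ideal.span (Set.range x))).map (C : A →+* A[X]) ⊔ Ideal.span {g ^ p ^ e} := by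
      refine mul_pow_mem_of_mul_pow_mem _ hq0 ?_
      have : c * m * f ^ p ^ e = c * (f ^ p ^ e * m) := by ring
      rw [this, hcjm]
      exact Ideal.mul_mem_left _ _ hj
    have h𝔵 : ∀ a : A, a ^ p ^ e ∈ frobeniusPower (p ^ e) (Ideal.span (Set.range x)) → a ∈ Ideal.span (Set.range x) :=
      fun a ha => hxF a ⟨e, ha⟩
    have hf' := mem_sup_span_of_pow_mem p (Ideal.span (Set.range x)) e h𝔵 hg hg1 hf'q
    have hunit : IsUnit (algebraMap A[X] (Localization.AtPrime P) (c * m)) :=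
      IsLocalization.map_units _ (⟨c * m, P.primeCompl.mul_mem hc hm⟩ : P.primeCompl)
    rw [← Ideal.unit_mul_mem_iff_mem _ hunit, IsLocalization.mul_mk'_eq_mk'_of_mul, IsLocalization.mk'_eq_mul_mk'_one]
    exact Ideal.mul_mem_right _ _ (hJ₁ (Ideal.mem_map_of_mem _ hf'))
  -- conclusion: every s.o.p. of `B`
  intro n hn u hu
  have husop : IsSystemOfParameters u := isSystemOfParameters_iff.mpr ⟨hn, hu⟩
  obtain rfl : n = d + 1 := by
    have h := hn.symm.trans hdimB
    exact_mod_cast h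
  exact ⟨hCMB u husop, (isFrobeniusClosed_iff p).mp
    (OneSop.isFrobeniusClosed_of_isFrobeniusClosed_sop p hCMB hs₀sop husop hF₀)⟩

end Summit.ResolutionOfSingularities.ResolutionOfSingularities.Theorems.FInjectiveMacaulayfication.PolynomialLocalizationClause

end
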